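import Summits.BirchSwinnertonDyer.Rank1Residual.X11b.Three.UnramifiedClassNodeLift
import HarnessLib

/-!
# T1 JET (cell `bsd-jet`), road K, K-GAP-2 (`h49str`), step (A1): the inertia-invariant Frobenius
# lift at a MULTIPLICATIVE place, with the lift recorded IN `E₀`

HONEST FRAMING (programme file §HONESTY, verbatim): «no tranche here proves BSD; ARM L moves the
LITERAL column of an r ≤ 1 census into the kernel-proved-modulo-named-print column.» THEOREMS ONLY
(seat `bsd-jet-pv-1`, session g7; `--supports stmt-BirchSwinnertonDyer-14418`, helper); 0 classes
move. WHAT THIS IS. x11b3-p8's `UnramifiedNode.exists_lift_sub_mem_kernel_of_hasMultiplicativeReductionAt`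
(`X11b/Three/UnramifiedClassNodeLift.lean`; Milne *ADT* I.3.8 Step 1 at a node: for `m ∈ E₀` an
`I_𝔐`-fixed `b ∈ V(K̄_v)` with `m − (φ b − b) ∈ V₁(K̄_v)`) CONSTRUCTS its `b` as the Hensel lift of a
nonsingular point of the node (its internal `hbE : b ∈ E₀`), but does not record `b ∈ E₀` in the
conclusion. Jetchev's stringent condition (Prop. 4.1 / 4.9: the coboundary witnessed IN `E⁰`) needs
it. This file re-runs that proof VERBATIM with the conclusion **`b ∈ E₀ ∧ …`** (nonsingular reduction
on the `𝒪_w`-model `M.map ι`, the same predicate as the hypothesis `hm`). No new mathematics.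
References: [cite: MilneADT2006, Ch. I Prop. 3.8 (proof)] [cite: SilvermanAEC2009, Prop. III.2.5(a),
Prop. VII.2.1, Exercise 3.5(a), Prop. VII.5.1(b)] [cite: Jetchev2008, Prop. 4.1 (pp. 819–821)].
-/

noncomputable section

open scoped Classical NNReal
open NumberField IsDedekindDomain Field Polynomial ValuativeRel

universe u

namespace Summit.BirchSwinnertonDyer.Rank1Residual.JET.StrongMilne

open WeierstrassCurve Literature.NumberTheory.EllipticCurves
  Literature.NumberTheory.EllipticCurves.FormalGroupChart
  Literature.NumberTheory.GaloisRepresentations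
  Literature.NumberTheory.GaloisRepresentations.IsNonarchimedeanLocalField IsDedekindDomain.HeightOneSpectrum
  Summit.BirchSwinnertonDyer.Rank1Residual.X11b.Three.UnramifiedNode
  Summit.BirchSwinnertonDyer.Rank1Residual.X11b.Three.JetchevKummer

/-! ### §4 Step 1 of Milne's proof at a node: the inertia-invariant Frobenius lift on `E₀` -/

section Main

variable {K : Type u} [Field K] [NumberField K] (W : WeierstrassCurve K) {v : HeightOneSpectrum (𝓞 K)}
  {w : Valuation (AlgebraicClosure (v.adicCompletion K)) ℝ≥0}
  (hw : ∀ x, (w x : ℝ) = spectralNorm (v.adicCompletion K) (AlgebraicClosure (v.adicCompletion K)) x)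
  {ι : v.adicCompletionIntegers K →+* w.integer}
  (hι : ∀ a, ((ι a : w.integer) : AlgebraicClosure (v.adicCompletion K)) =
    algebraMap (v.adicCompletion K) (AlgebraicClosure (v.adicCompletion K)) (a : v.adicCompletion K))

include hw in
set_option maxHeartbeats 1600000 in
/-- **Milne ADT I.3.8, Step 1 at a place of MULTIPLICATIVE reduction, with the lift IN `E₀`.**
x11b3-p8's `exists_lift_sub_mem_kernel_of_hasMultiplicativeReductionAt` re-run verbatim, recording
that the `I_𝔐`-fixed lift `b` (the Hensel lift of a nonsingular point of the node `W̃₀`, or `0` when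
`m ∈ V₁`) has NONSINGULAR reduction on `W₀ = M.map ι`: for `m ∈ E₀` there is `b ∈ E₀` fixed by
`I_𝔐` with `m − (φ b − b) ∈ V₁(K̄_v)`. [cite: MilneADT2006, Ch. I Prop. 3.8 (proof)]
[cite: SilvermanAEC2009, Prop. III.2.5(a), Prop. VII.2.1, Exercise 3.5(a)] -/
theorem exists_lift_sub_mem_kernel_of_hasMultiplicativeReductionAt_mem [W.IsElliptic]
    (hmult : W.HasMultiplicativeReductionAt v)
    {𝔐 : Ideal v.localAbsIntegers} (h𝔐 : 𝔐 ∈ v.localPrimesAbove)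
    [hV : (((W.localMinimalIntegralModel v).map
        (algebraMap (v.adicCompletionIntegers K) (v.adicCompletion K))).baseChange
        (AlgebraicClosure (v.adicCompletion K))).IsIntegral w.integer]
    (hι : ∀ a, ((ι a : w.integer) : AlgebraicClosure (v.adicCompletion K)) =
      algebraMap (v.adicCompletion K) (AlgebraicClosure (v.adicCompletion K)) (a : v.adicCompletion K))
    {φ : absoluteGaloisGroup (v.adicCompletion K)}
    (hφq : ∀ z : AlgebraicClosure (v.adicCompletion K), w z ≤ 1 →
      w (absoluteGaloisGroup.toAlgEquiv (v.adicCompletion K) φ z -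
        z ^ Nat.card (IsLocalRing.ResidueField (v.adicCompletionIntegers K))) < 1)
    (m : (((W.localMinimalIntegralModel v).map
        (algebraMap (v.adicCompletionIntegers K) (v.adicCompletion K))).baseChange
        (AlgebraicClosure (v.adicCompletion K))).toAffine.Point)
    (hm : ((W.localMinimalIntegralModel v).map ι).HasNonsingularReduction
      (Affine.Point.congrEquiv (baseChange_map_eq_baseChange_map hι (W.localMinimalIntegralModel v)) m)) :
    ∃ b : (((W.localMinimalIntegralModel v).map
        (algebraMap (v.adicCompletionIntegers K) (v.adicCompletion K))).baseChange
        (AlgebraicClosure (v.adicCompletion K))).toAffine.Point,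
      ((W.localMinimalIntegralModel v).map ι).HasNonsingularReduction
        (Affine.Point.congrEquiv (baseChange_map_eq_baseChange_map hι (W.localMinimalIntegralModel v)) b) ∧
      (∀ τ ∈ 𝔐.inertia (absoluteGaloisGroup (v.adicCompletion K)),
        WeierstrassCurve.Affine.Point.map (W' := (W.localMinimalIntegralModel v).map (algebraMap (v.adicCompletionIntegers K) (v.adicCompletion K))) ((absoluteGaloisGroup.toAlgEquiv (v.adicCompletion K) τ :
          AlgebraicClosure (v.adicCompletion K) ≃ₐ[v.adicCompletion K] AlgebraicClosure (v.adicCompletion K)) :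
          AlgebraicClosure (v.adicCompletion K) →ₐ[v.adicCompletion K] AlgebraicClosure (v.adicCompletion K)) b = b) ∧
      m - (WeierstrassCurve.Affine.Point.map (W' := (W.localMinimalIntegralModel v).map (algebraMap (v.adicCompletionIntegers K) (v.adicCompletion K))) ((absoluteGaloisGroup.toAlgEquiv (v.adicCompletion K) φ :
          AlgebraicClosure (v.adicCompletion K) ≃ₐ[v.adicCompletion K] AlgebraicClosure (v.adicCompletion K)) :
          AlgebraicClosure (v.adicCompletion K) →ₐ[v.adicCompletion K] AlgebraicClosure (v.adicCompletion K)) b - b)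
        ∈ FormalGroupChart.kernel w (((W.localMinimalIntegralModel v).map
            (algebraMap (v.adicCompletionIntegers K) (v.adicCompletion K))).baseChange
            (AlgebraicClosure (v.adicCompletion K))) := by
  have hvw : w.Integers w.integer := Valuation.integer.integers w
  have hφw : ∀ z, w (absoluteGaloisGroup.toAlgEquiv (v.adicCompletion K) φ z) = w z :=
    fun z ↦ spectralValuation_smul hw φ z
  have hq2 := two_le_natCard_residueField (K := K) (v := v)
  haveI : IsAlgClosed (IsLocalRing.ResidueField w.integer) := isAlgClosed_residueField_integer w
  -- the curve `V` is elliptic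
  haveI hVell : ((((W.localMinimalIntegralModel v).map (algebraMap (v.adicCompletionIntegers K) (v.adicCompletion K))).baseChange (AlgebraicClosure (v.adicCompletion K)))).IsElliptic := by
    haveI := W.isElliptic_localMinimalModel v
    have hM : (W.localMinimalIntegralModel v).map (algebraMap (v.adicCompletionIntegers K) (v.adicCompletion K)) = W.localMinimalModel v :=
      baseChange_integralModel_eq (v.adicCompletionIntegers K) (W.localMinimalModel v)
    rw [hM]
    infer_instance
  -- the model over `𝒪_w`
  have hX : ((W.localMinimalIntegralModel v).map (algebraMap (v.adicCompletionIntegers K) (v.adicCompletion K))).baseChange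
      (AlgebraicClosure (v.adicCompletion K)) = ((W.localMinimalIntegralModel v).map ι).baseChange (AlgebraicClosure (v.adicCompletion K)) :=
    baseChange_map_eq_baseChange_map hι (W.localMinimalIntegralModel v)
  -- kernel membership is reduction to `O` on `((W.localMinimalIntegralModel v).map ι)`
  have hker : ∀ P : (((W.localMinimalIntegralModel v).map (algebraMap (v.adicCompletionIntegers K) (v.adicCompletion K))).baseChange
      (AlgebraicClosure (v.adicCompletion K))).toAffine.Point,
      ((W.localMinimalIntegralModel v).map ι).ReducesToZero (Affine.Point.congrEquiv hX P) ↔ P ∈ FormalGroupChart.kernel w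
        (((W.localMinimalIntegralModel v).map (algebraMap (v.adicCompletionIntegers K) (v.adicCompletion K))).baseChange
          (AlgebraicClosure (v.adicCompletion K))) := by
    intro P
    rcases P with _ | ⟨x, y, h⟩
    · rw [← Affine.Point.zero_def, map_zero]
      exact iff_of_true WeierstrassCurve.reducesToZero_zero
        (fun he ↦ (Affine.Point.some_ne_zero _ he.symm).elim)
    · rw [Affine.Point.congrEquiv_some, WeierstrassCurve.reducesToZero_some_iff,
        not_mem_range_iff hvw, FormalGroupChart.some_mem_kernel_iff]
  -- the node presentation of `W̃₀` and the reduction map onto the torus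
  obtain ⟨x₀, y₀, α₁, α₂, hα, hW⟩ :=
    exists_map_residue_eq_singularModel_of_hasMultiplicativeReductionAt hw hι hmult
  obtain ⟨r, hr0, hr⟩ := exists_addMonoidHom_units_of_map_eq_singularModel ((W.localMinimalIntegralModel v).map ι) hvw hW hα
  -- the Galois rule for `φ` (Silverman Ex. 3.5(a))
  obtain ⟨σk, hσk, hstab, -, -, hdich⟩ := exists_residueMap_nodeReduction_smul ((W.localMinimalIntegralModel v).map ι) hX
    ((absoluteGaloisGroup.toAlgEquiv (v.adicCompletion K) φ :
      AlgebraicClosure (v.adicCompletion K) ≃ₐ[v.adicCompletion K] AlgebraicClosure (v.adicCompletion K)) :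
      AlgebraicClosure (v.adicCompletion K) →ₐ[v.adicCompletion K] AlgebraicClosure (v.adicCompletion K))
    (fun z ↦ hφw z) hW r hr0 hr
  -- `φ̄` is the `q`-power map of `k_{𝒪_w}`
  have hσkq : ∀ x : IsLocalRing.ResidueField w.integer,
      σk x = x ^ Nat.card (IsLocalRing.ResidueField (v.adicCompletionIntegers K)) := by
    intro x
    obtain ⟨z, rfl⟩ := IsLocalRing.residue_surjective x
    have hz : w (z : AlgebraicClosure (v.adicCompletion K)) ≤ 1 := z.2
    have hφz : w (absoluteGaloisGroup.toAlgEquiv (v.adicCompletion K) φ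
        (z : AlgebraicClosure (v.adicCompletion K))) ≤ 1 := by rw [hφw]; exact hz
    have hzq : w ((z : AlgebraicClosure (v.adicCompletion K)) ^
        Nat.card (IsLocalRing.ResidueField (v.adicCompletionIntegers K))) ≤ 1 := by
      rw [map_pow]; exact pow_le_one₀ zero_le hz
    have h1 := hσk (z : AlgebraicClosure (v.adicCompletion K)) hz hφz
    rw [h1]
    refine (WeierstrassCurve.residue_eq_of_val_sub_lt_one (w := w) hzq hφz (hφq _ hz)).trans ?_
    rw [← map_pow]
    exact congrArg _ (Subtype.ext (by simp))
  -- `m` in `E₀`, its value `a = r(m)`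
  have hmE : Affine.Point.congrEquiv hX m ∈ ((W.localMinimalIntegralModel v).map ι).nonsingularReductionSubgroup hvw := hm
  have ha0 : ((Additive.toMul (r ⟨_, hmE⟩) : (IsLocalRing.ResidueField w.integer)ˣ) :
      IsLocalRing.ResidueField w.integer) ≠ 0 := (Additive.toMul (r ⟨_, hmE⟩)).ne_zero
  -- trivial case `m ∈ V₁`
  by_cases hrm : r ⟨_, hmE⟩ = 0
  · refine ⟨0, by rw [map_zero]; exact WeierstrassCurve.hasNonsingularReduction_zero, fun τ _ ↦ by rw [map_zero], ?_⟩
    rw [map_zero, sub_self, sub_zero]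
    exact (hker m).mp ((hr0 ⟨_, hmE⟩).mp hrm)
  -- the Galois rule as a signed exponent `e = ±1`: `r(φ P) = ((r P)^q)^e`
  obtain ⟨e, he, hrule⟩ : ∃ e : ℤ, (e = 1 ∨ e = -1) ∧
      ∀ (P : (((W.localMinimalIntegralModel v).map (algebraMap (v.adicCompletionIntegers K) (v.adicCompletion K))).baseChange
          (AlgebraicClosure (v.adicCompletion K))).toAffine.Point)
        (hP : ((W.localMinimalIntegralModel v).map ι).HasNonsingularReduction (Affine.Point.congrEquiv hX P))
        (hσP : ((W.localMinimalIntegralModel v).map ι).HasNonsingularReduction (Affine.Point.congrEquiv hX (Affine.Point.map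
          ((absoluteGaloisGroup.toAlgEquiv (v.adicCompletion K) φ :
            AlgebraicClosure (v.adicCompletion K) ≃ₐ[v.adicCompletion K] AlgebraicClosure (v.adicCompletion K)) :
            AlgebraicClosure (v.adicCompletion K) →ₐ[v.adicCompletion K] AlgebraicClosure (v.adicCompletion K)) P))),
        ((Additive.toMul (r ⟨_, hσP⟩) : (IsLocalRing.ResidueField w.integer)ˣ) :
            IsLocalRing.ResidueField w.integer) =
          ((((Additive.toMul (r ⟨_, hP⟩) : (IsLocalRing.ResidueField w.integer)ˣ) :
            IsLocalRing.ResidueField w.integer)) ^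
              Nat.card (IsLocalRing.ResidueField (v.adicCompletionIntegers K))) ^ e := by
    rcases hdich with ⟨-, -, h⟩ | ⟨-, -, h⟩
    · exact ⟨1, Or.inl rfl, fun P hP hσP ↦ by rw [zpow_one, h P hP hσP, hσkq]⟩
    · exact ⟨-1, Or.inr rfl, fun P hP hσP ↦ by rw [zpow_neg_one, h P hP hσP, hσkq]⟩
  -- "Lang for the torus": `a · β = (β^q)^e`
  obtain ⟨β, hβ0, hβ⟩ : ∃ β : IsLocalRing.ResidueField w.integer, β ≠ 0 ∧
      ((Additive.toMul (r ⟨_, hmE⟩) : (IsLocalRing.ResidueField w.integer)ˣ) :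
        IsLocalRing.ResidueField w.integer) * β =
        (β ^ Nat.card (IsLocalRing.ResidueField (v.adicCompletionIntegers K))) ^ e := by
    rcases he with rfl | rfl
    · obtain ⟨β, hβ0, hβ⟩ := exists_pow_eq_mul_self hq2 ha0
      exact ⟨β, hβ0, by rw [zpow_one, hβ]⟩
    · obtain ⟨β, hβ0, hβ⟩ :=
        exists_mul_mul_pow_eq_one (Nat.card (IsLocalRing.ResidueField (v.adicCompletionIntegers K))) ha0
      refine ⟨β, hβ0, ?_⟩
      rw [zpow_neg_one, ← mul_eq_one_iff_eq_inv₀ (pow_ne_zero _ hβ0)]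
      exact hβ
  -- the point of `Ẽ_ns` with `ψ`-value `β`; it is not `Õ` since `a ≠ 1`
  obtain ⟨Q, hQ⟩ := singularModel.nodeHom_surjective (x₀ := x₀) (y₀ := y₀) hα
    (Additive.ofMul (Units.mk0 β hβ0))
  rcases Q with _ | ⟨αQ, βQ, hnsQ⟩
  · exfalso
    rw [← Affine.Point.zero_def, map_zero] at hQ
    have hβ1 : β = 1 := by
      have h1 := congrArg (fun t ↦ ((Additive.toMul t : (IsLocalRing.ResidueField w.integer)ˣ) :
        IsLocalRing.ResidueField w.integer)) hQ
      simpa using h1.symm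
    rw [hβ1, mul_one, one_pow, one_zpow] at hβ
    apply hrm
    apply Additive.toMul.injective
    ext
    rw [toMul_zero, Units.val_one]
    exact hβ
  -- the lift of `Q = (αQ, βQ)` to an `I_𝔐`-invariant `𝒪_w`-point `(a₁, b₁)` of `((W.localMinimalIntegralModel v).map ι)`
  have hnsW : (((W.localMinimalIntegralModel v).map ι).map (IsLocalRing.residue w.integer)).toAffine.Nonsingular αQ βQ := by
    rw [hW]; exact hnsQ
  obtain ⟨a₁, b₁, hab, ha₁, hb₁, ha₁I, hb₁I⟩ := exists_lift_forall_inertia hw hι h𝔐 (W.localMinimalIntegralModel v) hnsW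
  have hL : (((W.localMinimalIntegralModel v).map (algebraMap (v.adicCompletionIntegers K) (v.adicCompletion K))).baseChange
      (AlgebraicClosure (v.adicCompletion K))).toAffine.Nonsingular
      (a₁ : AlgebraicClosure (v.adicCompletion K)) (b₁ : AlgebraicClosure (v.adicCompletion K)) := by
    rw [← Affine.equation_iff_nonsingular, hX]
    exact (map_equation_iff hvw.hom_inj).mpr hab
  have hL' : (((W.localMinimalIntegralModel v).map ι).baseChange (AlgebraicClosure (v.adicCompletion K))).toAffine.Nonsingular
      (algebraMap w.integer (AlgebraicClosure (v.adicCompletion K)) a₁)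
      (algebraMap w.integer (AlgebraicClosure (v.adicCompletion K)) b₁) := by
    have h := hL; rw [hX] at h; exact h
  have hns_res : (singularModel x₀ y₀ α₁ α₂).toAffine.Nonsingular (IsLocalRing.residue w.integer a₁)
      (IsLocalRing.residue w.integer b₁) := by
    rw [ha₁, hb₁]; exact hnsQ
  have hbE' : ∀ h', ((W.localMinimalIntegralModel v).map ι).HasNonsingularReduction
      (.some (algebraMap w.integer (AlgebraicClosure (v.adicCompletion K)) a₁)
        (algebraMap w.integer (AlgebraicClosure (v.adicCompletion K)) b₁) h') := fun h' ↦
    (hasNonsingularReduction_some_algebraMap_iff hvw.hom_inj h').mpr (by rw [hW]; exact hns_res)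
  have hcongr : Affine.Point.congrEquiv hX (.some _ _ hL) = .some _ _ hL' := by
    rw [Affine.Point.congrEquiv_some]; rfl
  have hbE : ((W.localMinimalIntegralModel v).map ι).HasNonsingularReduction (Affine.Point.congrEquiv hX (.some _ _ hL)) := by
    rw [hcongr]; exact hbE' _
  -- `r(b) = β`
  have hrb : ((Additive.toMul (r ⟨_, hbE⟩) : (IsLocalRing.ResidueField w.integer)ˣ) :
      IsLocalRing.ResidueField w.integer) = β := by
    have h1 : (⟨Affine.Point.congrEquiv hX (.some _ _ hL), hbE⟩ : ((W.localMinimalIntegralModel v).map ι).nonsingularReductionSubgroup hvw) =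
        ⟨.some _ _ hL', hbE' hL'⟩ := Subtype.ext hcongr
    rw [h1, hr a₁ b₁ hL' hns_res (hbE' hL')]
    have h2 : (WeierstrassCurve.Affine.Point.some _ _ hns_res :
        (singularModel x₀ y₀ α₁ α₂).toAffine.Point) = .some αQ βQ hnsQ :=
      point_some_eq_some ha₁ hb₁
    rw [h2, ← singularModel.coe_toMul_nodeHom, hQ]
    rfl
  -- `φ b ∈ E₀`, and `b` is fixed by `I_𝔐`
  have hφbE := hstab _ hbE
  refine ⟨.some _ _ hL, hbE, fun τ hτ ↦ ?_, ?_⟩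
  · rw [Affine.Point.map_some]
    exact point_some_eq_some (ha₁I τ hτ) (hb₁I τ hτ)
  -- `r(m - (φ b - b)) = a · β / (β^q)^e = 1`
  have key : r (⟨_, hmE⟩ - (⟨_, hφbE⟩ - ⟨_, hbE⟩)) = 0 := by
    rw [map_sub, map_sub]
    apply Additive.toMul.injective
    rw [toMul_sub, toMul_sub, toMul_zero]
    ext
    rw [Units.val_div_eq_div_val, Units.val_div_eq_div_val, Units.val_one, hrule _ hbE hφbE, hrb,
      div_div_eq_mul_div, div_eq_one_iff_eq (zpow_ne_zero _ (pow_ne_zero _ hβ0)), hβ]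
  have hred := (hr0 _).mp key
  rw [← hker]
  simpa only [AddSubgroupClass.coe_sub, map_sub] using hred

end Main

end Summit.BirchSwinnertonDyer.Rank1Residual.JET.StrongMilne

end
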